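import Summits.Ventures.PercRepro.RankLevelSetHallCoopShareLevel
import Summits.Ventures.PercRepro.RankLevelSetHallCoopShareArith

/-!
# PercRepro — THE COLOOP-SHARE KERNEL ON THE RANK-`(q+1)` LEVEL, PART 2: THE TWO BOUNDS AND THE PER-PAIR RECEIPT
(p4, gen 38; the `k = 2` module RankLevelSetHallCoopShareBounds restated for any cell `(p, q)` with `q + 2 ≤ p` at the tight
layer `#E = p + q`; paper proofs/P4-CRUX-K2.md Lemmas 2–4, whose proofs never use `k = 2`)

For a member `Z`, a set `R` with `Z ⊆ R ⊆ cl Z` (`#R = q + j`) and `o ∈ E ∖ cl Z`, the set `R ∪ {o}` is a `Y`-set of rank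
`q + 1` at which `Z` has weight `1 / (ℓ(R ∪ {o}) · b(R))` (`csWeight_insert_eq`).  With `u` the number of **coloops of
`M|R`** (`csColoops`) every member inside `R` contains all of them (`csColoops_subset_of_mem_memberBases`), so
`b(R) ≤ C(#R − u, q − u)` (`ncard_memberBases_le`), and a used coloop `x ≠ o` of `R ∪ {o}` is a coloop of `R`
(`usedColoops_insert_subset`), so `ℓ(R ∪ {o}) ≤ 1 + u`.  The hockey stick of the arithmetic module then gives
**`csWeight_insert_ge`**: the weight is at least `1 / C(q + j + 1, j + 1)`, uniformly in the matroid and in `p`.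

* `csColoops`, `csColoops_subset`, `csColoops_subset_of_mem_memberBases`, `ncard_csColoops_le`;
* `ncard_memberBases_le`, `usedColoops_insert_subset`, `ncard_usedColoops_insert_le`;
* `eRk_eq_of_between`, `eRk_insert_eq_succ`, `mem_cellY_insert`, `insert_sdiff_closure_eq`, `csWeight_insert_eq`,
  `mem_usedColoops_insert`;
* **`csWeight_insert_ge`**.
Axioms: standard.
-/

namespace PercRepro.Level

open Set Matroid Finset

variable {α : Type} (M : Matroid α) [M.Finite]

/-- The **coloops of `M|R`** (for `R` of rank `q`): the `x ∈ R` with `r(R ∖ {x}) < q`. -/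
def csColoops (q : ℕ) (R : Set α) : Set α := {x | x ∈ R ∧ M.eRk (R \ {x}) < (q : ℕ∞)}

omit [M.Finite] in
/-- The coloops of `R` lie in `R`. -/
theorem csColoops_subset (q : ℕ) (R : Set α) : csColoops M q R ⊆ R := fun _ hx => hx.1

omit [M.Finite] in
/-- **Every member inside `R` contains every coloop of `R`**: a member missing `x` would lie in `R ∖ {x}`, of rank `< q`. -/
theorem csColoops_subset_of_mem_memberBases (p q : ℕ) {R Z : Set α} (hZ : Z ∈ memberBases M p q R) :
    csColoops M q R ⊆ Z := by
  intro x hx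
  by_contra hxZ
  have hsub : Z ⊆ R \ {x} := by
    intro y hy
    refine ⟨hZ.2 hy, ?_⟩
    intro hyx
    rw [Set.mem_singleton_iff] at hyx
    rw [hyx] at hy
    exact hxZ hy
  have h1 : M.eRk Z ≤ M.eRk (R \ {x}) := M.eRk_mono hsub
  rw [eRk_eq_of_mem_cellMembers M p q hZ.1] at h1
  exact absurd (lt_of_le_of_lt h1 hx.2) (lt_irrefl _)

/-- A set with a member-basis has at most `q` coloops. -/
theorem ncard_csColoops_le (p q : ℕ) (hE : M.E.ncard = p + q) {R Z : Set α} (hZ : Z ∈ memberBases M p q R) :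
    (csColoops M q R).ncard ≤ q := by
  have h := Set.ncard_le_ncard (csColoops_subset_of_mem_memberBases M p q hZ) (M.set_finite Z hZ.1.1)
  rw [ncard_eq_q_of_mem_cellMembers_tight M hE hZ.1] at h
  exact h

/-- **The member-bases of `R` number at most `C(#R − u, q − u)`**, `u` the number of coloops of `R`: each contains all
the coloops, and `Z ↦ Z ∖ C` injects them into the `(q − u)`-subsets of `R ∖ C`. -/
theorem ncard_memberBases_le (p q : ℕ) (hE : M.E.ncard = p + q) {R : Set α} (hR : R ⊆ M.E) :
    (memberBases M p q R).ncard ≤ (R.ncard - (csColoops M q R).ncard).choose (q - (csColoops M q R).ncard) := by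
  classical
  set C : Set α := csColoops M q R with hC
  have hCR : C ⊆ R := csColoops_subset M q R
  have hRfin : R.Finite := M.set_finite R hR
  have hXfin : (R \ C).Finite := hRfin.subset sdiff_subset
  set Xf : Finset α := hXfin.toFinset with hXf
  have hXcard : Xf.card = R.ncard - C.ncard := by
    rw [hXf, ← ncard_eq_toFinset_card _ hXfin, Set.ncard_sdiff' hCR hRfin]
  set Pf : Finset (Set α) := (Xf.powersetCard (q - C.ncard)).image (fun T : Finset α => ((T : Set α) ∪ C)) with hPf
  have hPcard : Pf.card ≤ (R.ncard - C.ncard).choose (q - C.ncard) := by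
    rw [hPf, ← hXcard, ← Finset.card_powersetCard]
    exact Finset.card_image_le
  have hsub : memberBases M p q R ⊆ (Pf : Set (Set α)) := by
    intro Z hZ
    have hCZ : C ⊆ Z := csColoops_subset_of_mem_memberBases M p q hZ
    have hZfin : Z.Finite := M.set_finite Z hZ.1.1
    have hZq : Z.ncard = q := ncard_eq_q_of_mem_cellMembers_tight M hE hZ.1
    have hZCfin : (Z \ C).Finite := hZfin.subset sdiff_subset
    rw [hPf, Finset.mem_coe, Finset.mem_image]
    refine ⟨hZCfin.toFinset, ?_, ?_⟩
    · rw [Finset.mem_powersetCard]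
      constructor
      · intro x hx
        rw [Set.Finite.mem_toFinset] at hx
        rw [hXf, Set.Finite.mem_toFinset]
        exact ⟨hZ.2 hx.1, hx.2⟩
      · rw [← ncard_eq_toFinset_card _ hZCfin, Set.ncard_sdiff' hCZ hZfin, hZq]
    · rw [Set.Finite.coe_toFinset]
      exact Set.sdiff_union_of_subset hCZ
  calc (memberBases M p q R).ncard ≤ (Pf : Set (Set α)).ncard := Set.ncard_le_ncard hsub (Set.toFinite _)
    _ = Pf.card := ncard_coe_finset Pf
    _ ≤ _ := hPcard

omit [M.Finite] in
/-- **The used coloops of `R ∪ {o}` are `o` and coloops of `R`** (`o ∉ cl R`): for `x ∈ R`,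
`r((R ∪ {o}) ∖ {x}) = r(R ∖ {x}) + 1`, so a used `x ≠ o` has `r(R ∖ {x}) < q`. -/
theorem usedColoops_insert_subset (p q : ℕ) {Z R : Set α} (hRcl : R ⊆ M.closure Z)
    {o : α} (ho : o ∈ M.E) (hocl : o ∉ M.closure Z) :
    usedColoops M p q (insert o R) ⊆ insert o (csColoops M q R) := by
  intro x hx
  obtain ⟨hxS, hrx, -⟩ := hx
  by_cases hxo : x = o
  · rw [hxo]; exact Set.mem_insert o _
  · have hxR : x ∈ R := by
      rcases hxS with h | h
      · exact absurd h hxo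
      · exact h
    refine Set.mem_insert_of_mem o ⟨hxR, ?_⟩
    -- (insert o R) \ {x} = insert o (R \ {x}) and o ∉ cl (R \ {x})
    have hset : (insert o R) \ {x} = insert o (R \ {x}) := by
      ext y
      simp only [Set.mem_sdiff, Set.mem_insert_iff, Set.mem_singleton_iff]
      constructor
      · rintro ⟨h | h, hyx⟩
        · exact Or.inl h
        · exact Or.inr ⟨h, hyx⟩
      · rintro (h | ⟨h, hyx⟩)
        · exact ⟨Or.inl h, by rw [h]; exact Ne.symm hxo⟩
        · exact ⟨Or.inr h, hyx⟩
    have hocl' : o ∈ M.E \ M.closure (R \ {x}) := by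
      refine ⟨ho, fun hmem => hocl ?_⟩
      have h1 : M.closure (R \ {x}) ⊆ M.closure R := M.closure_subset_closure sdiff_subset
      have h2 : M.closure R ⊆ M.closure Z := M.closure_subset_closure_of_subset_closure hRcl
      exact h2 (h1 hmem)
    rw [hset, M.eRk_insert_eq_add_one hocl'] at hrx
    -- from r(R ∖ {x}) + 1 = q deduce r(R ∖ {x}) < q
    have hne : M.eRk (R \ {x}) ≠ ⊤ := by
      intro htop
      rw [htop, top_add] at hrx
      exact ENat.coe_ne_top q hrx.symm
    obtain ⟨n, hn⟩ := ENat.ne_top_iff_exists.1 hne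
    rw [← hn] at hrx ⊢
    have hn' : n + 1 = q := by exact_mod_cast hrx
    exact_mod_cast (show n < q by omega)

/-- `ℓ(R ∪ {o}) ≤ 1 + u`. -/
theorem ncard_usedColoops_insert_le (p q : ℕ) {Z R : Set α} (hRcl : R ⊆ M.closure Z)
    {o : α} (ho : o ∈ M.E) (hocl : o ∉ M.closure Z) :
    (usedColoops M p q (insert o R)).ncard ≤ (csColoops M q R).ncard + 1 := by
  have hRE : R ⊆ M.E := hRcl.trans (M.closure_subset_ground Z)
  have hfin : (insert o (csColoops M q R)).Finite :=
    ((M.set_finite R hRE).subset (csColoops_subset M q R)).insert o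
  calc (usedColoops M p q (insert o R)).ncard ≤ (insert o (csColoops M q R)).ncard :=
        Set.ncard_le_ncard (usedColoops_insert_subset M p q hRcl ho hocl) hfin
    _ ≤ (csColoops M q R).ncard + 1 := Set.ncard_insert_le o _

omit [M.Finite] in
/-- A set `R` with `Z ⊆ R ⊆ cl Z` has rank `q`. -/
theorem eRk_eq_of_between (p q : ℕ) {Z R : Set α} (hZ : Z ∈ cellMembers M p q) (hZR : Z ⊆ R)
    (hRcl : R ⊆ M.closure Z) : M.eRk R = (q : ℕ∞) := by
  apply le_antisymm
  · calc M.eRk R ≤ M.eRk (M.closure Z) := M.eRk_mono hRcl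
      _ = (q : ℕ∞) := by rw [M.eRk_closure_eq, eRk_eq_of_mem_cellMembers M p q hZ]
  · rw [← eRk_eq_of_mem_cellMembers M p q hZ]
    exact M.eRk_mono hZR

omit [M.Finite] in
/-- `R ∪ {o}` has rank `q + 1` for `Z ⊆ R ⊆ cl Z` and `o ∈ E ∖ cl Z`. -/
theorem eRk_insert_eq_succ (p q : ℕ) {Z R : Set α} (hZ : Z ∈ cellMembers M p q) (hZR : Z ⊆ R)
    (hRcl : R ⊆ M.closure Z) {o : α} (ho : o ∈ M.E) (hocl : o ∉ M.closure Z) :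
    M.eRk (insert o R) = ((q + 1 : ℕ) : ℕ∞) := by
  have hocl' : o ∈ M.E \ M.closure R := by
    refine ⟨ho, fun hmem => hocl ?_⟩
    exact (M.closure_subset_closure_of_subset_closure hRcl) hmem
  rw [M.eRk_insert_eq_add_one hocl', eRk_eq_of_between M p q hZ hZR hRcl]
  push_cast
  rfl

omit [M.Finite] in
/-- `R ∪ {o}` is a `Y`-set of the cell `(p, q)` (`q + 2 ≤ p`) for `Z ⊆ R ⊆ cl Z` and `o ∈ E ∖ cl Z`. -/
theorem mem_cellY_insert (p q : ℕ) (hp : q + 2 ≤ p) {Z R : Set α} (hZ : Z ∈ cellMembers M p q) (hZR : Z ⊆ R)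
    (hRcl : R ⊆ M.closure Z) {o : α} (ho : o ∈ M.E) (hocl : o ∉ M.closure Z) :
    insert o R ∈ cellY M p q := by
  have hRE : R ⊆ M.E := hRcl.trans (M.closure_subset_ground Z)
  have hr := eRk_insert_eq_succ M p q hZ hZR hRcl ho hocl
  refine ⟨Set.insert_subset ho hRE, ?_, ?_⟩
  · rw [hr]
    exact_mod_cast (show q < q + 1 by omega)
  · rw [hr]
    exact_mod_cast (show q + 1 < p by omega)

omit [M.Finite] in
/-- `(R ∪ {o}) ∖ cl Z = {o}` and `(R ∪ {o}) ∩ cl Z = R` for `R ⊆ cl Z`, `o ∉ cl Z`. -/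
theorem insert_sdiff_closure_eq (Z R : Set α) (hRcl : R ⊆ M.closure Z) {o : α} (hocl : o ∉ M.closure Z) :
    (insert o R) \ M.closure Z = {o} ∧ (insert o R) ∩ M.closure Z = R := by
  constructor
  · ext x
    simp only [Set.mem_sdiff, Set.mem_insert_iff, Set.mem_singleton_iff]
    constructor
    · rintro ⟨h | h, hx⟩
      · exact h
      · exact absurd (hRcl h) hx
    · intro h
      rw [h]
      exact ⟨Or.inl rfl, hocl⟩
  · ext x
    simp only [Set.mem_inter_iff, Set.mem_insert_iff]
    constructor
    · rintro ⟨h | h, hx⟩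
      · rw [h] at hx; exact absurd hx hocl
      · exact h
    · intro h
      exact ⟨Or.inr h, hRcl h⟩

omit [M.Finite] in
/-- **The weight of `Z` at `R ∪ {o}`** (`Z ⊆ R ⊆ cl Z`, `o ∈ E ∖ cl Z`): `1 / (ℓ(R ∪ {o}) · b(R))`. -/
theorem csWeight_insert_eq (p q : ℕ) (hp : q + 2 ≤ p) {Z R : Set α} (hZ : Z ∈ cellMembers M p q) (hZR : Z ⊆ R)
    (hRcl : R ⊆ M.closure Z) {o : α} (ho : o ∈ M.E) (hocl : o ∉ M.closure Z) :
    csWeight M p q Z (insert o R)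
      = 1 / (((usedColoops M p q (insert o R)).ncard : ℚ) * ((memberBases M p q R).ncard : ℚ)) := by
  classical
  obtain ⟨h1, h2⟩ := insert_sdiff_closure_eq M Z R hRcl hocl
  unfold csWeight
  rw [if_pos ⟨hZ, mem_cellY_insert M p q hp hZ hZR hRcl ho hocl, eRk_insert_eq_succ M p q hZ hZR hRcl ho hocl,
    hZR.trans (Set.subset_insert o R), by rw [h1, Set.ncard_singleton]⟩, h2]

omit [M.Finite] in
/-- `o` is a used coloop of `R ∪ {o}`. -/
theorem mem_usedColoops_insert (p q : ℕ) {Z R : Set α} (hZ : Z ∈ cellMembers M p q) (hZR : Z ⊆ R)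
    (hRcl : R ⊆ M.closure Z) {o : α} (hocl : o ∉ M.closure Z) : o ∈ usedColoops M p q (insert o R) := by
  have hoR : o ∉ R := fun h => hocl (hRcl h)
  refine ⟨Set.mem_insert o R, ?_, Z, hZ, ?_⟩
  · rw [Set.insert_sdiff_self_of_notMem hoR]
    exact eRk_eq_of_between M p q hZ hZR hRcl
  · intro x hx
    exact ⟨Set.mem_insert_of_mem o (hZR hx), fun hxo => hoR (by rw [Set.mem_singleton_iff] at hxo; rw [← hxo]; exact hZR hx)⟩

/-- **The per-pair lower bound**: for `Z ⊆ R ⊆ cl Z` with `#R = q + j` and `o ∈ E ∖ cl Z`,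
`csWeight Z (R ∪ {o}) ≥ 1 / C(q + j + 1, j + 1)` — by `ℓ ≤ 1 + u`, `b ≤ C(q + j − u, j)` and the hockey stick. -/
theorem csWeight_insert_ge (p q : ℕ) (hp : q + 2 ≤ p) (hE : M.E.ncard = p + q) {Z R : Set α} (hZ : Z ∈ cellMembers M p q)
    (hZR : Z ⊆ R) (hRcl : R ⊆ M.closure Z) {o : α} (ho : o ∈ M.E) (hocl : o ∉ M.closure Z) :
    1 / (((q + (R.ncard - q) + 1).choose ((R.ncard - q) + 1) : ℕ) : ℚ) ≤ csWeight M p q Z (insert o R) := by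
  have hRE : R ⊆ M.E := hRcl.trans (M.closure_subset_ground Z)
  have hZmem : Z ∈ memberBases M p q R := ⟨hZ, hZR⟩
  have hZq : Z.ncard = q := ncard_eq_q_of_mem_cellMembers_tight M hE hZ
  have hRq : q ≤ R.ncard := by
    rw [← hZq]
    exact Set.ncard_le_ncard hZR (M.set_finite R hRE)
  set j : ℕ := R.ncard - q with hj
  set u : ℕ := (csColoops M q R).ncard with hu
  have hu_le : u ≤ q := ncard_csColoops_le M p q hE hZmem
  set ℓ : ℕ := (usedColoops M p q (insert o R)).ncard with hℓ
  set b : ℕ := (memberBases M p q R).ncard with hb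
  have hℓ_le : ℓ ≤ u + 1 := ncard_usedColoops_insert_le M p q hRcl ho hocl
  have hb_le : b ≤ (q + j - u).choose j := by
    have h := ncard_memberBases_le M p q hE hRE
    have hRn : R.ncard - u = q + j - u := by omega
    rw [hRn] at h
    have hsym : (q + j - u).choose (q - u) = (q + j - u).choose j := by
      have : q - u = (q + j - u) - j := by omega
      rw [this]
      exact Nat.choose_symm (by omega)
    rw [hsym] at h
    exact h
  have hℓ_pos : 1 ≤ ℓ := by
    have hne : (usedColoops M p q (insert o R)).Nonempty := ⟨o, mem_usedColoops_insert M p q hZ hZR hRcl hocl⟩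
    have hfin : (usedColoops M p q (insert o R)).Finite :=
      usedColoops_finite M p q _ (Set.insert_subset ho hRE)
    exact (Set.ncard_pos hfin).2 hne
  have hb_pos : 1 ≤ b := by
    have hne : (memberBases M p q R).Nonempty := ⟨Z, hZmem⟩
    exact (Set.ncard_pos (memberBases_finite M p q R)).2 hne
  have hprod : ℓ * b ≤ (q + j + 1).choose (j + 1) := by
    calc ℓ * b ≤ (u + 1) * (q + j - u).choose j := Nat.mul_le_mul hℓ_le hb_le
      _ = (1 + u) * (q + j - u).choose j := by ring
      _ ≤ (q + j + 1).choose (j + 1) := CoopShare.one_add_mul_choose_le q j u hu_le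
  rw [csWeight_insert_eq M p q hp hZ hZR hRcl ho hocl]
  have hpos : (0 : ℚ) < (ℓ : ℚ) * (b : ℚ) := by
    have : 0 < ℓ * b := Nat.mul_pos hℓ_pos hb_pos
    exact_mod_cast this
  apply one_div_le_one_div_of_le hpos
  exact_mod_cast hprod

end PercRepro.Level
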